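import Literature.Topology.FourManifolds.SimplifiedBrokenLefschetzSidesGenus
import Literature.Topology.FourManifolds.SimplifiedBrokenLefschetzRoundCircle
import Literature.Topology.FourManifolds.CircleNormalFraming
import HarnessLib

/-!
# The frame hypothesis of the fold normal form, reduced to a periodic frame along any tube

Helper `helper_foldNF_frame_of_periodicFrame` of stub `helper_sliceGluing_foldNormalForm` (the
`S¹`-parametric fold normal form of the round circle), line `Sketch`, crux `SblfDescent.RungOne`.

(Crux item stmt-SmoothPoincare4-18531; skeleton `Cruxes/RungOne/Lines/Sketch.lean`.)

The hypothesis `helper_foldNF_frame` of `helper_foldNF_ofFrame` asks for SOME round circle `e`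
by longitude, SOME tube `ν₀` about it and a `1`-periodic `C^∞` frame adapted to the page
Hessians of the height along `ν₀`.  The first two exist unconditionally in the tree
(`IsSimplifiedBrokenLefschetzFibration.exists_isSmoothEmbedding_range_eq_round`: the round
locus is an embedded circle parametrised by longitude; `nonempty_circleNbhd_of_compactSpace`:
circles in compact orientable `4`-manifolds have tubular neighbourhoods).  So the frame
hypothesis follows from the sharper residual statement `helper_foldNF_periodicFrame`: for EVERY
such `e`, `ν₀` the page Hessians admit a periodic adapted frame (the untwistedness of the round
`1`-handle; pointwise frames exist by `helper_foldNF_pageHessian`).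

## References

* R. İ. Baykur, S. Kamada, *Classification of broken Lefschetz fibrations with small fiber
  genera*, J. Math. Soc. Japan 67 (2015), §2, §5. [BaykurKamada2015]
* A. A. Kosinski, *Differential Manifolds* (1993), III, Cor. 2.3. [Kosinski1993]
-/

set_option linter.dupNamespace false

noncomputable section

open scoped Manifold ContDiff Topology RealInnerProductSpace
open Set Function Filter Metric Literature.Topology.FourManifolds
  Literature.AlgebraicTopology.SingularHomology

namespace Summit.SmoothPoincare4.SmoothPoincare4.Cruxes.RungOne.Sketch

/-- Local notation: `𝔼 n` is the model Euclidean space `EuclideanSpace ℝ (Fin n)`. -/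
local notation "𝔼 " n:arg => EuclideanSpace ℝ (Fin n)

/-- Local notation: `𝕊²`, the unit sphere of `ℝ³`. -/
local notation "𝕊²" => (Metric.sphere (0 : EuclideanSpace ℝ (Fin 3)) (1 : ℝ))

attribute [local instance] Literature.Topology.FourManifolds.fact_finrank_euclideanSpace_succ

/-- **The frame hypothesis from a periodic frame along any tube.**  If for every round circle
`e` by longitude and every tube `ν₀` about it the page Hessians of the height admit a
`1`-periodic `C^∞` adapted frame, then the hypothesis `helper_foldNF_frame` of the fold normal
form holds: take the round circle of `exists_isSmoothEmbedding_range_eq_round` and a tube of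
`nonempty_circleNbhd_of_compactSpace` (`X` is compact and oriented by `o`).
[cite: BaykurKamada2015, §2] -/
theorem helper_foldNF_frame_of_periodicFrame : (∀ (X : Type) [TopologicalSpace X] [T2Space X] [SecondCountableTopology X] [CompactSpace X] [ChartedSpace (𝔼 4) X] [IsManifold (𝓡 4) ∞ X] (o : SmoothOrientation (𝓡 4) X) (f : X → 𝕊²), IsSimplifiedBrokenLefschetzFibration o f ∅ 0 → f '' ({p : X | ¬ Surjective (mfderiv (𝓡 4) (𝓡 2) f p)} \ (↑(∅ : Finset X) : Set X)) = sphereEquator 1 → ∀ (v : 𝕊²), (v : 𝔼 3) 0 = 0 → (v : 𝔼 3) 1 = 0 → (∀ y : 𝕊², ⟪(y : 𝔼 3), (v : 𝔼 3)⟫ < 0 → (∀ q, f q = y → Surjective (mfderiv (𝓡 4) (𝓡 2) f q)) ∧ Nonempty ((Fin (2 * 0) → ℤ) ≃ₗ[ℤ] singularHomology ℤ ℤ ↥(f ⁻¹' {y}) 1)) → (∀ y : 𝕊², ⟪(y : 𝔼 3), ((-v : 𝕊²) : 𝔼 3)⟫ < 0 → (∀ q, f q = y → Surjective (mfderiv (𝓡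 4) (𝓡 2) f q)) ∧ Nonempty ((Fin (2 * (0 + 1)) → ℤ) ≃ₗ[ℤ] singularHomology ℤ ℤ ↥(f ⁻¹' {y}) 1)) → ∀ (e : Metric.sphere (0 : 𝔼 2) 1 → X) (ν₀ : CircleNbhd (𝓡 4) e), Set.range e = {p : X | ¬ Surjective (mfderiv (𝓡 4) (𝓡 2) f p)} \ (↑(∅ : Finset X) : Set X) → (∀ u, f (e u) = sphereInclusion 1 2 one_le_two u) → ∃ (M Minv : ℝ → (𝔼 3 →L[ℝ] 𝔼 3)), ContDiff ℝ ∞ M ∧ ContDiff ℝ ∞ Minv ∧ (∀ t : ℝ, M (t + 1) = M t) ∧ (∀ t : ℝ, Minv (t + 1) = Minv t) ∧ (∀ (t : ℝ) (a : 𝔼 3), M t (Minv t a) = a) ∧ (∀ (t : ℝ) (a : 𝔼 3), Minv t (M t a) = a) ∧ (∀ (t : ℝ) (a b : 𝔼 3), fderiv ℝ (fderiv ℝ (fun q : ℝ × 𝔼 3 => SphereHeight.height (v : 𝔼 3) (f (ν₀.toFun (circlePt q.1, q.2))))) (t, 0) ((0 : ℝ), a) ((0 : ℝ), b) = 2 *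 ((M t a) 0 * (M t b) 0 + (M t a) 1 * (M t b) 1 - (M t a) 2 * (M t b) 2))) → ∀ (X : Type) [TopologicalSpace X] [T2Space X] [SecondCountableTopology X] [CompactSpace X] [ChartedSpace (𝔼 4) X] [IsManifold (𝓡 4) ∞ X] (o : SmoothOrientation (𝓡 4) X) (f : X → 𝕊²), IsSimplifiedBrokenLefschetzFibration o f ∅ 0 → f '' ({p : X | ¬ Surjective (mfderiv (𝓡 4) (𝓡 2) f p)} \ (↑(∅ : Finset X) : Set X)) = sphereEquator 1 → ∀ (v : 𝕊²), (v : 𝔼 3) 0 = 0 → (v : 𝔼 3) 1 = 0 → (∀ y : 𝕊², ⟪(y : 𝔼 3), (v : 𝔼 3)⟫ < 0 → (∀ q, f q = y → Surjective (mfderiv (𝓡 4) (𝓡 2) f q)) ∧ Nonempty ((Fin (2 * 0) → ℤ) ≃ₗ[ℤ] singularHomology ℤ ℤ ↥(f ⁻¹' {y}) 1)) → (∀ y : 𝕊², ⟪(y : 𝔼 3), ((-v : 𝕊²) : 𝔼 3)⟫ < 0 → (∀ q, f q = y → Surjective (mfderiv (𝓡 4) (𝓡 2) f q)) ∧ Nonempty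 ((Fin (2 * (0 + 1)) → ℤ) ≃ₗ[ℤ] singularHomology ℤ ℤ ↥(f ⁻¹' {y}) 1)) → (∃ (e : Metric.sphere (0 : 𝔼 2) 1 → X) (ν₀ : CircleNbhd (𝓡 4) e) (M Minv : ℝ → (𝔼 3 →L[ℝ] 𝔼 3)), Set.range e = {p : X | ¬ Surjective (mfderiv (𝓡 4) (𝓡 2) f p)} \ (↑(∅ : Finset X) : Set X) ∧ (∀ u, f (e u) = sphereInclusion 1 2 one_le_two u) ∧ ContDiff ℝ ∞ M ∧ ContDiff ℝ ∞ Minv ∧ (∀ t : ℝ, M (t + 1) = M t) ∧ (∀ t : ℝ, Minv (t + 1) = Minv t) ∧ (∀ (t : ℝ) (a : 𝔼 3), M t (Minv t a) = a) ∧ (∀ (t : ℝ) (a : 𝔼 3), Minv t (M t a) = a) ∧ (∀ (t : ℝ) (a b : 𝔼 3), fderiv ℝ (fderiv ℝ (fun q : ℝ × 𝔼 3 => SphereHeight.height (v : 𝔼 3) (f (ν₀.toFun (circlePt q.1, q.2))))) (t, 0) ((0 : ℝ), a) ((0 : ℝ), b) = 2 * ((M t a) 0 * (M t b) 0 + (M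 t a) 1 * (M t b) 1 - (M t a) 2 * (M t b) 2))) := by
  intro hpf X _ _ _ _ _ _ o f hf hround v hv0 hv1 hlo hhi
  obtain ⟨e, he, hrange, hfe⟩ := hf.exists_isSmoothEmbedding_range_eq_round hround
  have hX : IsOrientable (𝓡 4) X := ⟨o⟩
  obtain ⟨ν₀⟩ := nonempty_circleNbhd_of_compactSpace hX e he
  obtain ⟨M, Minv, hM, hMinv, hMT, hMinvT, hMM, hMM', hadapt⟩ :=
    hpf X o f hf hround v hv0 hv1 hlo hhi e ν₀ hrange hfe
  exact ⟨e, ν₀, M, Minv, hrange, hfe, hM, hMinv, hMT, hMinvT, hMM, hMM', hadapt⟩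

end Summit.SmoothPoincare4.SmoothPoincare4.Cruxes.RungOne.Sketch

end
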